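import Summits.CriticalPhenomena.CardyFormulaZ2.Theorems.CardyQContinuationIsingJetsConformalStubSandwichLower
import Summits.CriticalPhenomena.CardyFormulaZ2.Theorems.CardyQContinuationIsingJetsConformalStubPathLower
import Summits.CriticalPhenomena.CardyFormulaZ2.Theorems.CardyQContinuationIsingJetsConformalStubRcMeasureWiredIsolated
import Literature.Probability.LatticeModels.FKIsingQuadrilateralCrossing
import Literature.Probability.LatticeModels.RandomClusterEmbedding

/-!
# Crux `IsingJetsConformal`, stub `stub_loopSymmetricLimit_lowerComparison`:
# the lower comparison of the `n = 0` sandwich, concrete form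
# (route `CardyQContinuation`, item stmt-CriticalPhenomena-5560)

A designed quadrilateral `E` (finite set of lattice edges, black = wired vertex sets `B₀, B₂`
of its arcs `0, 2`) is glued OUTSIDE the tree's discretisation `Ω_δ` of a conformal rectangle
`R` (vertices `meshDomain R.carrier δ`, graph `discreteDomainGraph`, wired arcs
`W₀ = discreteArc R.carrier δ (R.arc 0)`, `W₂`): the black vertices lie off `meshDomain`, the
non-`Ω_δ` edges of `E` fall into two collars `C₀, C₂`, a collar-`C₀` edge touches a vertex
having an `Ω_δ`-neighbour only inside `W₀` (similarly `C₂` / `W₂`), no vertex sees both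
collars, and the `E`-edges at a black vertex of arc `0` (resp. `2`) are `C₀`- (resp. `C₂`-)
edges. Then `φ^{B₀ ∪ B₂}_{⟨E⟩,p,q}(B₀ ↔ B₂) ≤ φ^{W₀ ∪ W₂}_{Ω_δ,p,q}(W₀ ↔ W₂)` (`0 ≤ p < 1`,
`q ≥ 1`), the right side being the `fkDomainMeasure`-probability of Smirnov's crossing event.

Proof (plumbing around the two abstract halves already landed): both graphs are placed on the
common finite vertex type `V = ↥(meshDomain ∪ verts E)` (edge sets `EΩ`, `EQ` = images of the
two edge sets along the inclusions `jΩ`, `jE`). The left side is rewritten on `V` by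
`rcMeasure_real_map_image` (idle vertices isolated and unwired); the abstract lower sandwich
`stub_loopSymmetricLimit_sandwichLower` on `G = ⟨EΩ ∪ EQ⟩` — its deterministic input being
`stub_loopSymmetricLimit_pathLower` with the pulled-back collars — bounds it by the measure of
`⟨EΩ⟩` wired on `jΩ(W₀ ∪ W₂)` and on the idle vertices (= the vertices off the range of `jΩ`
and the images of the isolated vertices of `Ω_δ`), which `rcMeasure_real_map_of_wired` and
`RcMeasureWiredIsolated.rcMeasure_union_eq_of_isolated` identify with `φ^{W₀ ∪ W₂}_{Ω_δ}` of
the intrinsic crossing event, i.e. with the `fkDomainMeasure` expression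
(`measureReal_fkDomainMeasure`, `mem_rectCrossing_iff`). The degenerate case `W₀ ∪ W₂ = ∅` is
trivial (the bounding event is empty).

References: G. Grimmett, *The Random-Cluster Model*, Springer (2006), §1.2, Lemmas (4.13),
(4.14); D. Chelkak, S. Smirnov, Invent. Math. 189 (2012), §6; S. Smirnov, Ann. Math. 172 (2010).
-/

namespace Summit.CriticalPhenomena.CardyFormulaZ2.Theorems.CardyQContinuation

open MeasureTheory SimpleGraph
open Literature.Probability.LatticeModels Literature.Probability.Percolation
open Literature.Probability.RandomPlanarGeometry

namespace LowerComparison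

section Transport

variable {X Y : Type*} (j : X ↪ Y)

/-- The crossing event is transported along an injection of vertex types: the image
configuration joins `j(B₁)` to `j(B₂)` iff the configuration joins `B₁` to `B₂`. [folklore] -/
theorem map_mem_arcCrossing_iff (ω : Set (Sym2 X)) (B₁ B₂ : Set X) :
    Sym2.map j '' ω ∈ arcCrossing (j '' B₁) (j '' B₂) ↔ ω ∈ arcCrossing B₁ B₂ := by
  have hmap : openGraph (Sym2.map j '' ω) = (openGraph ω).map j := fromEdgeSet_image_eq_map j ω
  rw [mem_arcCrossing_iff, mem_arcCrossing_iff, hmap]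
  constructor
  · rintro ⟨_, ⟨x, hx, rfl⟩, _, ⟨y, hy, rfl⟩, hr⟩
    obtain ⟨y', hy', hxy'⟩ := exists_of_reachable_map j _ hr
    obtain rfl : y = y' := j.injective hy'
    exact ⟨x, hx, y, hy, hxy'⟩
  · rintro ⟨x, hx, y, hy, hr⟩
    exact ⟨j x, ⟨x, hx, rfl⟩, j y, ⟨y, hy, rfl⟩, reachable_map_of_reachable j _ hr⟩

/-- The image of the edge set of a graph along an injection, unfolded: its members are the pairs
`{j a, j b}` over the edges `ab`. [folklore] -/
theorem mem_map_sym2Map_iff (G : SimpleGraph X) {i : Fintype G.edgeSet} (e : Sym2 Y) :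
    e ∈ (@edgeFinset X G i).map j.sym2Map ↔ ∃ a b, G.Adj a b ∧ e = s(j a, j b) := by
  rw [Finset.mem_map]
  constructor
  · rintro ⟨e₀, he₀, rfl⟩
    induction e₀ using Sym2.ind with
    | h a b => exact ⟨a, b, (@mem_edgeFinset X G _ i).1 he₀, rfl⟩
  · rintro ⟨a, b, hab, rfl⟩
    exact ⟨s(a, b), (@mem_edgeFinset X G _ i).2 hab, rfl⟩

/-- The image of an edge set has no diagonal pairs. [folklore] -/
theorem not_isDiag_of_mem_map (G : SimpleGraph X) {i : Fintype G.edgeSet} {e : Sym2 Y}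
    (he : e ∈ (@edgeFinset X G i).map j.sym2Map) : ¬ e.IsDiag := by
  obtain ⟨a, b, hab, rfl⟩ := (mem_map_sym2Map_iff j G e).1 he
  rw [Sym2.mk_isDiag_iff]
  exact fun h => hab.ne (j.injective h)

/-- The edge set of the graph `⟨F⟩` spanned by a finite set `F` of non-diagonal pairs is `F` (for
every `Fintype` instance). [folklore] -/
theorem mem_edgeFinset_fromEdgeSet_iff_of_not_isDiag {F : Finset (Sym2 Y)}
    (hF : ∀ e ∈ F, ¬ e.IsDiag) {i : Fintype (fromEdgeSet (F : Set (Sym2 Y))).edgeSet}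
    {e : Sym2 Y} : e ∈ @edgeFinset Y (fromEdgeSet (F : Set (Sym2 Y))) i ↔ e ∈ F := by
  rw [@mem_edgeFinset Y _ e i, edgeSet_fromEdgeSet, Set.mem_sdiff, Finset.mem_coe,
    Sym2.mem_diagSet]
  exact ⟨fun h => h.1, fun h => ⟨h, hF e h⟩⟩

end Transport

/-- **The left side on the common vertex type** (`rcMeasure_real_map_image`, idle vertices
isolated and unwired): the crossing probability of `⟨E⟩` wired on `B₀ ∪ B₂` equals that of the
image graph `⟨EQ⟩`, `EQ = jE(E(⟨E⟩))`, wired on `jE(B₀ ∪ B₂)`. [folklore] -/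
theorem lhs_eq {V : Type*} [Fintype V] [DecidableEq V] (E : Finset (Sym2 (Site 2)))
    [DecidableRel (DiscreteRect.graph E).Adj] {p q : ℝ} (hp : p ∈ Set.Icc (0 : ℝ) 1)
    (hq : 0 < q) (jE : ((DiscreteRect.verts E : Finset (Site 2)) : Set (Site 2)) ↪ V)
    (B₀ B₂ : Set ((DiscreteRect.verts E : Finset (Site 2)) : Set (Site 2))) :
    (rcMeasure (DiscreteRect.graph E) p q (B₀ ∪ B₂)).real (arcCrossing B₀ B₂) =
      (rcMeasure (fromEdgeSet
          (((DiscreteRect.graph E).edgeFinset.map jE.sym2Map : Finset (Sym2 V)) : Set (Sym2 V)))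
          p q (jE '' (B₀ ∪ B₂))).real (arcCrossing (jE '' B₀) (jE '' B₂)) := by
  symm
  refine rcMeasure_real_map_image jE (Finset.ext fun _ =>
    mem_edgeFinset_fromEdgeSet_iff_of_not_isDiag fun e he => not_isDiag_of_mem_map jE _ he)
    hp hq (B₀ ∪ B₂) fun ω _ => ?_
  rw [coe_map_sym2Map, map_mem_arcCrossing_iff]

/-- **The right side on the common vertex type.** With `EΩ = jΩ(E(Ω_δ))` and nonempty wired arcs
`WΩ = rectArc 0 ∪ rectArc 2`, the measure of `⟨EΩ⟩` wired on `jΩ(WΩ)` and on the idle vertices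
(the vertices off the range of `jΩ` and the images of the isolated vertices of `Ω_δ`) gives the
pulled-back crossing event its `φ^{WΩ}_{Ω_δ}`-probability: `rcMeasure_real_map_of_wired` lands on
the wired set `WΩ ∪ {isolated}`, and wiring isolated vertices is harmless
(`RcMeasureWiredIsolated.rcMeasure_union_eq_of_isolated`). [folklore] -/
theorem rhs_eq {V : Type*} [Fintype V] [DecidableEq V] (R : ConformalRectangle) (δ : ℝ)
    [Fintype (meshDomain R.carrier δ)] [DecidableRel (domainSubgraph R.carrier δ).Adj]
    {p q : ℝ} (hp : p ∈ Set.Icc (0 : ℝ) 1) (hq : 0 < q) (jΩ : meshDomain R.carrier δ ↪ V)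
    (EΩ : Finset (Sym2 V)) (hEΩ : EΩ = (domainSubgraph R.carrier δ).edgeFinset.map jΩ.sym2Map)
    (hne : (rectArc R δ 0 ∪ rectArc R δ 2).Nonempty) :
    (rcMeasure (fromEdgeSet (EΩ : Set (Sym2 V))) p q
        (jΩ '' (rectArc R δ 0 ∪ rectArc R δ 2) ∪ {x | ∀ e' ∈ EΩ, x ∉ e'})).real
        {ω | ω ∩ (EΩ : Set (Sym2 V)) ∈ arcCrossing (jΩ '' rectArc R δ 0) (jΩ '' rectArc R δ 2)} =
      (rcMeasure (domainSubgraph R.carrier δ) p q (rectArc R δ 0 ∪ rectArc R δ 2)).real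
        (arcCrossing (rectArc R δ 0) (rectArc R δ 2)) := by
  rw [← RcMeasureWiredIsolated.rcMeasure_union_eq_of_isolated (domainSubgraph R.carrier δ)
    (I := {x | ∀ y, ¬ (domainSubgraph R.carrier δ).Adj x y}) (fun x hx => hx) p hq _]
  subst hEΩ
  have hmem := mem_map_sym2Map_iff jΩ (domainSubgraph R.carrier δ)
    (i := (domainSubgraph R.carrier δ).fintypeEdgeSet)
  refine rcMeasure_real_map_of_wired jΩ (Finset.ext fun _ =>
    mem_edgeFinset_fromEdgeSet_iff_of_not_isDiag fun e he => not_isDiag_of_mem_map jΩ _ he)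
    hp hq (hne.mono Set.subset_union_left) (fun u => ⟨?_, fun h => ?_⟩) fun ω hω => ?_
  · -- wired on `V` ⟹ every preimage is in `WΩ ∪ Iso`
    rintro (⟨w, hw, rfl⟩ | hu) x hx
    · exact Or.inl (jΩ.injective hx ▸ hw)
    · refine Or.inr fun y hxy => hu _ ((hmem _).2 ⟨x, y, hxy, rfl⟩) ?_
      rw [← hx]
      exact Sym2.mem_mk_left _ _
  · -- every preimage in `WΩ ∪ Iso` ⟹ wired on `V`
    by_cases hu : ∃ x, jΩ x = u
    · obtain ⟨x, rfl⟩ := hu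
      rcases h x rfl with hW | hI
      · exact Or.inl ⟨x, hW, rfl⟩
      · refine Or.inr fun e' he' hxe' => ?_
        obtain ⟨a, b, hab, rfl⟩ := (hmem e').1 he'
        rcases Sym2.mem_iff.1 hxe' with h' | h'
        · exact hI b (jΩ.injective h' ▸ hab)
        · exact hI a (jΩ.injective h' ▸ hab.symm)
    · refine Or.inr fun e' he' hue' => ?_
      obtain ⟨a, b, -, rfl⟩ := (hmem e').1 he'
      rcases Sym2.mem_iff.1 hue' with rfl | rfl
      · exact hu ⟨a, rfl⟩
      · exact hu ⟨b, rfl⟩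
  · -- the events correspond
    have hsub : Sym2.map jΩ '' (↑ω : Set (Sym2 (meshDomain R.carrier δ))) ⊆
        ↑((domainSubgraph R.carrier δ).edgeFinset.map jΩ.sym2Map) := by
      rintro _ ⟨e, he, rfl⟩
      exact Finset.mem_coe.2 (Finset.mem_map_of_mem _ (hω he))
    rw [Set.mem_setOf_eq, coe_map_sym2Map, Set.inter_eq_left.2 hsub, map_mem_arcCrossing_iff]

open scoped Classical in
/-- **Smirnov's crossing probability as an `rcMeasure` probability**: the `fkDomainMeasure` of
`Ω_δ` wired on the discrete arc of `(ab) ∪ (cd)` gives the crossing event `C_δ(Ω; (ab), (cd))`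
the `φ^{rectArc 0 ∪ rectArc 2}_{Ω_δ}`-probability of the intrinsic crossing event (same finite
sums: `measureReal_fkDomainMeasure`, `measureReal_rcMeasure`, `rectArc_zero_union_two`,
`mem_rectCrossing_iff`). [folklore] -/
theorem fkDomainMeasure_real_discreteCrossing_eq (R : ConformalRectangle) (δ : ℝ)
    [Fintype (meshDomain R.carrier δ)] {p q : ℝ} (hp : p ∈ Set.Icc (0 : ℝ) 1) (hq : 0 < q) :
    (fkDomainMeasure R.carrier δ p q (R.arc 0 ∪ R.arc 2)).real
        (discreteCrossing R.carrier δ (R.arc 0) (R.arc 2)) =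
      (rcMeasure (domainSubgraph R.carrier δ) p q (rectArc R δ 0 ∪ rectArc R δ 2)).real
        (arcCrossing (rectArc R δ 0) (rectArc R δ 2)) := by
  rw [measureReal_fkDomainMeasure _ _ hp hq, measureReal_rcMeasure _ hp hq,
    ← rectArc_zero_union_two]
  congr 1
  refine Finset.sum_congr ?_ fun _ _ => rfl
  ext ω
  simp only [Finset.mem_filter, Finset.mem_powerset, and_congr_right_iff]
  intro hω
  rw [← coe_mem_rectCrossing_iff]
  exact mem_rectCrossing_iff R fun e he => mem_edgeFinset.1 (hω he)

section Glue

variable {V : Type} {val : V → Site 2} {R : ConformalRectangle} {δ : ℝ}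
  {E : Finset (Sym2 (Site 2))} {jΩ : meshDomain R.carrier δ ↪ V}
  {jE : ((DiscreteRect.verts E : Finset (Site 2)) : Set (Site 2)) ↪ V} {EΩ EQ : Finset (Sym2 V)}

/-- A vertex of an `EΩ`-edge is a vertex of `Ω_δ` with an `Ω_δ`-neighbour. [folklore] -/
theorem val_mem_of_mem_EΩ (hjΩ : ∀ u, val (jΩ u) = u)
    (hEΩ : ∀ e, e ∈ EΩ ↔ ∃ a b, (domainSubgraph R.carrier δ).Adj a b ∧ e = s(jΩ a, jΩ b))
    {e : Sym2 V} (he : e ∈ EΩ) {x : V} (hx : x ∈ e) :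
    val x ∈ meshDomain R.carrier δ ∧ ∃ y, (discreteDomainGraph R.carrier δ).Adj (val x) y := by
  obtain ⟨a, b, hab, rfl⟩ := (hEΩ e).1 he
  have hab' : (discreteDomainGraph R.carrier δ).Adj a.1 b.1 := hab
  rcases Sym2.mem_iff.1 hx with rfl | rfl
  · exact ⟨(hjΩ a).symm ▸ a.2, b.1, (hjΩ a).symm ▸ hab'⟩
  · exact ⟨(hjΩ b).symm ▸ b.2, a.1, (hjΩ b).symm ▸ hab'.symm⟩

/-- An `EQ`-edge projects to an `E`-edge, and it is an `EΩ`-edge as soon as its projection is an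
`Ω_δ`-edge. [folklore] -/
theorem map_val_of_mem_EQ (hval : Function.Injective val) (hjΩ : ∀ u, val (jΩ u) = u)
    (hjE : ∀ a, val (jE a) = a)
    (hEΩ : ∀ e, e ∈ EΩ ↔ ∃ a b, (domainSubgraph R.carrier δ).Adj a b ∧ e = s(jΩ a, jΩ b))
    (hEQ : ∀ e, e ∈ EQ ↔ ∃ a b, (DiscreteRect.graph E).Adj a b ∧ e = s(jE a, jE b))
    {e : Sym2 V} (he : e ∈ EQ) :
    Sym2.map val e ∈ E ∧
      (Sym2.map val e ∈ (discreteDomainGraph R.carrier δ).edgeSet → e ∈ EΩ) := by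
  obtain ⟨a, b, hab, rfl⟩ := (hEQ e).1 he
  have hab' : s(a.1, b.1) ∈ (E : Set (Sym2 (Site 2))) ∧ a.1 ≠ b.1 := hab
  rw [Sym2.map_mk, hjE, hjE]
  refine ⟨hab'.1, fun hΩ => ?_⟩
  have hadj : (discreteDomainGraph R.carrier δ).Adj a.1 b.1 := hΩ
  obtain ⟨-, ha, hb⟩ := discreteDomainGraph_adj_iff.1 hadj
  refine (hEΩ _).2 ⟨⟨a.1, ha⟩, ⟨b.1, hb⟩, hadj, ?_⟩
  rw [hval ((hjE a).trans (hjΩ ⟨a.1, ha⟩).symm), hval ((hjE b).trans (hjΩ ⟨b.1, hb⟩).symm)]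

/-- A vertex of `Ω_δ`-origin lying in a wired arc is the image of a vertex of `rectArc`.
[folklore] -/
theorem mem_image_rectArc (hval : Function.Injective val) (hjΩ : ∀ u, val (jΩ u) = u) {x : V}
    {i : Fin 4} (hx : val x ∈ discreteArc R.carrier δ (R.arc i)) : x ∈ jΩ '' rectArc R δ i := by
  have hxm : val x ∈ meshDomain R.carrier δ :=
    meshBoundary_subset_meshDomain _ _ (discreteArc_subset_meshBoundary _ _ _ hx)
  exact ⟨⟨val x, hxm⟩, hx, hval (hjΩ ⟨val x, hxm⟩)⟩

/-- **Attachment hypothesis of the abstract sandwich**: an edge of `G = ⟨EΩ ∪ EQ⟩` off `EΩ`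
touches a vertex incident to some `EΩ`-edge only inside `jΩ(rectArc 0 ∪ rectArc 2)`. [folklore] -/
theorem attach (hval : Function.Injective val) (hjΩ : ∀ u, val (jΩ u) = u)
    (hjE : ∀ a, val (jE a) = a)
    (hEΩ : ∀ e, e ∈ EΩ ↔ ∃ a b, (domainSubgraph R.carrier δ).Adj a b ∧ e = s(jΩ a, jΩ b))
    (hEQ : ∀ e, e ∈ EQ ↔ ∃ a b, (DiscreteRect.graph E).Adj a b ∧ e = s(jE a, jE b))
    {C₀ C₂ : Set (Sym2 (Site 2))}
    (h3 : ∀ e ∈ E, e ∉ (discreteDomainGraph R.carrier δ).edgeSet → e ∈ C₀ ∪ C₂)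
    (h4 : ∀ x : Site 2, (∃ e ∈ C₀, x ∈ e) → (∃ y, (discreteDomainGraph R.carrier δ).Adj x y) →
      x ∈ discreteArc R.carrier δ (R.arc 0))
    (h5 : ∀ x : Site 2, (∃ e ∈ C₂, x ∈ e) → (∃ y, (discreteDomainGraph R.carrier δ).Adj x y) →
      x ∈ discreteArc R.carrier δ (R.arc 2))
    {e : Sym2 V} (he : e ∈ EΩ ∨ e ∈ EQ) (heΩ : e ∉ EΩ) {x : V} (hx : x ∈ e) :
    x ∈ jΩ '' (rectArc R δ 0 ∪ rectArc R δ 2) ∨ ∀ e' ∈ EΩ, x ∉ e' := by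
  have heQ : e ∈ EQ := he.resolve_left heΩ
  by_cases hx' : ∃ e' ∈ EΩ, x ∈ e'
  · obtain ⟨e', he', hxe'⟩ := hx'
    obtain ⟨-, hy⟩ := val_mem_of_mem_EΩ hjΩ hEΩ he' hxe'
    obtain ⟨hE, hΩ⟩ := map_val_of_mem_EQ hval hjΩ hjE hEΩ hEQ heQ
    have hC := h3 _ hE fun h => heΩ (hΩ h)
    have hxv : val x ∈ Sym2.map val e := Sym2.mem_map.2 ⟨x, hx, rfl⟩
    rw [Set.image_union]
    rcases hC with hC | hC
    · exact Or.inl (Or.inl (mem_image_rectArc hval hjΩ (h4 _ ⟨_, hC, hxv⟩ hy)))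
    · exact Or.inl (Or.inr (mem_image_rectArc hval hjΩ (h5 _ ⟨_, hC, hxv⟩ hy)))
  · push Not at hx'
    exact Or.inr hx'

/-- **Deterministic hypothesis of the abstract sandwich** (`stub_loopSymmetricLimit_pathLower`
with the pulled-back collars `{e | val(e) ∈ C₀}`, `{e | val(e) ∈ C₂}`): a lattice configuration
`ω ⊆ E(G)`, `E(G) ⊆ EΩ ∪ EQ`, whose `EQ`-part joins `jE(B₀)` to `jE(B₂)` has an `EΩ`-part
joining `jΩ(rectArc 0)` to `jΩ(rectArc 2)`. [folklore] -/
theorem forces (hval : Function.Injective val) (hjΩ : ∀ u, val (jΩ u) = u)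
    (hjE : ∀ a, val (jE a) = a)
    (hEΩ : ∀ e, e ∈ EΩ ↔ ∃ a b, (domainSubgraph R.carrier δ).Adj a b ∧ e = s(jΩ a, jΩ b))
    (hEQ : ∀ e, e ∈ EQ ↔ ∃ a b, (DiscreteRect.graph E).Adj a b ∧ e = s(jE a, jE b))
    {B₀ B₂ : Set (Site 2)} {C₀ C₂ : Set (Sym2 (Site 2))} (h1 : Disjoint B₀ B₂)
    (h2 : ∀ v ∈ B₀ ∪ B₂, v ∉ meshDomain R.carrier δ)
    (h3 : ∀ e ∈ E, e ∉ (discreteDomainGraph R.carrier δ).edgeSet → e ∈ C₀ ∪ C₂)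
    (h4 : ∀ x : Site 2, (∃ e ∈ C₀, x ∈ e) → (∃ y, (discreteDomainGraph R.carrier δ).Adj x y) →
      x ∈ discreteArc R.carrier δ (R.arc 0))
    (h5 : ∀ x : Site 2, (∃ e ∈ C₂, x ∈ e) → (∃ y, (discreteDomainGraph R.carrier δ).Adj x y) →
      x ∈ discreteArc R.carrier δ (R.arc 2))
    (h6 : ∀ x : Site 2, (∃ e ∈ C₀, x ∈ e) → ¬ ∃ e ∈ C₂, x ∈ e)
    (h7 : ∀ x ∈ B₀, ∀ e ∈ E, x ∈ e → e ∈ C₀) (h8 : ∀ y ∈ B₂, ∀ e ∈ E, y ∈ e → e ∈ C₂)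
    {G : SimpleGraph V} (hG : ∀ e ∈ G.edgeSet, e ∈ EΩ ∨ e ∈ EQ) {ω : BondConfig V}
    (hω : ω ⊆ G.edgeSet)
    (hAQ : ω ∩ (EQ : Set (Sym2 V)) ∈
      arcCrossing (jE '' {a | a.1 ∈ B₀}) (jE '' {a | a.1 ∈ B₂})) :
    ω ∩ (EΩ : Set (Sym2 V)) ∈ arcCrossing (jΩ '' rectArc R δ 0) (jΩ '' rectArc R δ 2) := by
  obtain ⟨_, ⟨a, ha, rfl⟩, _, ⟨b, hb, rfl⟩, hr⟩ := hAQ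
  have hr' : (openGraph ω).Reachable (jE a) (jE b) :=
    hr.mono (openGraph_mono Set.inter_subset_left)
  have hxv : ∀ {x : V} {e : Sym2 V}, x ∈ e → val x ∈ Sym2.map val e := fun {x e} hx =>
    Sym2.mem_map.2 ⟨x, hx, rfl⟩
  -- the edges of `G` at a black vertex: collar edges, off `EΩ`
  have hblack : ∀ {B : Set (Site 2)} {C : Set (Sym2 (Site 2))},
      (∀ v ∈ B, v ∉ meshDomain R.carrier δ) → (∀ x ∈ B, ∀ e ∈ E, x ∈ e → e ∈ C) →
      ∀ {c : ((DiscreteRect.verts E : Finset (Site 2)) : Set (Site 2))}, c.1 ∈ B →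
      ∀ e ∈ G.edgeSet, jE c ∈ e →
        e ∈ {e : Sym2 V | Sym2.map val e ∈ C} ∧ e ∉ (EΩ : Set (Sym2 V)) := by
    intro B C hB hC c hc e he hce
    have heΩ : e ∉ EΩ := fun h => hB _ hc ((hjE c) ▸ (val_mem_of_mem_EΩ hjΩ hEΩ h hce).1)
    have hmem := (map_val_of_mem_EQ hval hjΩ hjE hEΩ hEQ ((hG e he).resolve_left heΩ)).1
    exact ⟨hC c.1 hc _ hmem ((hjE c) ▸ hxv hce), fun h => heΩ (Finset.mem_coe.1 h)⟩
  refine stub_loopSymmetricLimit_pathLower V G ↑EΩ {e | Sym2.map val e ∈ C₀}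
    {e | Sym2.map val e ∈ C₂} (jΩ '' rectArc R δ 0) (jΩ '' rectArc R δ 2) ω hω ?_ ?_ ?_ ?_
    (jE a) (jE b) ?_ (hblack (fun v hv => h2 v (Or.inl hv)) h7 ha)
    (hblack (fun v hv => h2 v (Or.inr hv)) h8 hb) hr'
  · -- the edges of `G` are covered by `EΩ` and the two pulled-back collars
    intro e he
    rcases hG e he with heΩ | heQ
    · exact Or.inl (Or.inl (Finset.mem_coe.2 heΩ))
    · obtain ⟨hE, hΩ⟩ := map_val_of_mem_EQ hval hjΩ hjE hEΩ hEQ heQ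
      by_cases h : Sym2.map val e ∈ (discreteDomainGraph R.carrier δ).edgeSet
      · exact Or.inl (Or.inl (Finset.mem_coe.2 (hΩ h)))
      · rcases h3 _ hE h with hC | hC
        · exact Or.inl (Or.inr hC)
        · exact Or.inr hC
  · rintro x ⟨e, he, hxe⟩ ⟨e', he', hxe'⟩
    exact mem_image_rectArc hval hjΩ
      (h4 _ ⟨_, he, hxv hxe⟩ (val_mem_of_mem_EΩ hjΩ hEΩ (Finset.mem_coe.1 he') hxe').2)
  · rintro x ⟨e, he, hxe⟩ ⟨e', he', hxe'⟩
    exact mem_image_rectArc hval hjΩ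
      (h5 _ ⟨_, he, hxv hxe⟩ (val_mem_of_mem_EΩ hjΩ hEΩ (Finset.mem_coe.1 he') hxe').2)
  · rintro x ⟨e, he, hxe⟩ ⟨e', he', hxe'⟩
    exact h6 (val x) ⟨_, he, hxv hxe⟩ ⟨_, he', hxv hxe'⟩
  · intro hab
    have : a.1 = b.1 := congrArg Subtype.val (jE.injective hab)
    exact Set.disjoint_left.1 h1 ha (this ▸ hb)

end Glue

end LowerComparison

open LowerComparison

/-- **Stub `stub_loopSymmetricLimit_lowerComparison`** of the skeleton of the crux
`IsingJetsConformal` (stmt-CriticalPhenomena-5560, `n = 0` bridge, LOWER comparison, concrete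
form): for a designed quadrilateral `E` glued outside the discretisation `Ω_δ` of a conformal
rectangle along its wired arcs (black vertices off `meshDomain`, non-`Ω_δ` edges in two collars
`C₀, C₂` touching `Ω_δ`-vertices only inside the wired arcs `W₀, W₂`, no vertex seeing both
collars, black vertices of arc `0` / `2` seeing only `C₀`- / `C₂`-edges),
`φ^{B₀ ∪ B₂}_{⟨E⟩,p,q}(B₀ ↔ B₂) ≤ φ^{W₀ ∪ W₂}_{Ω_δ,p,q}(C_δ(Ω; (ab), (cd)))` for `0 ≤ p < 1`,
`q ≥ 1`: common vertex type `↥(meshDomain ∪ verts E)`, `LowerComparison.lhs_eq`,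
`stub_loopSymmetricLimit_sandwichLower` fed by `LowerComparison.attach` / `forces`
(`stub_loopSymmetricLimit_pathLower`), `LowerComparison.rhs_eq`,
`LowerComparison.fkDomainMeasure_real_discreteCrossing_eq`. (Grimmett 2006, Lemmas (4.13),
(4.14); Chelkak–Smirnov 2012, §6.) [folklore] -/
theorem stub_loopSymmetricLimit_lowerComparison : (∀ (R : Literature.Probability.RandomPlanarGeometry.ConformalRectangle) (δ p q : ℝ), 0 < δ → p ∈ Set.Icc (0 : ℝ) 1 → p < 1 → 1 ≤ q → ∀ [Fintype (Literature.Probability.LatticeModels.meshDomain R.carrier δ)] (E : Finset (Sym2 (Literature.Probability.LatticeModels.Site 2))) (d₀ : Literature.Probability.LatticeModels.Site 2 × Fin 4) (n : Fin 4 → ℕ) [DecidableRel (Literature.Probability.LatticeModels.DiscreteRect.graph E).Adj] (C₀ C₂ : Set (Sym2 (Literature.Probability.LatticeModels.Site 2))), Disjoint (Literature.Probability.LatticeModels.DiscreteRect.blackVerts E d₀ n 0) (Literature.Probability.LatticeModels.DiscreteRect.blackVerts E d₀ n 2) → (∀ v ∈ Literature.Probability.LatticeModels.DiscreteRect.blackVerts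 E d₀ n 0 ∪ Literature.Probability.LatticeModels.DiscreteRect.blackVerts E d₀ n 2, v ∉ Literature.Probability.LatticeModels.meshDomain R.carrier δ) → (∀ e ∈ E, e ∉ (Literature.Probability.LatticeModels.discreteDomainGraph R.carrier δ).edgeSet → e ∈ C₀ ∪ C₂) → (∀ x : Literature.Probability.LatticeModels.Site 2, (∃ e ∈ C₀, x ∈ e) → (∃ y, (Literature.Probability.LatticeModels.discreteDomainGraph R.carrier δ).Adj x y) → x ∈ Literature.Probability.LatticeModels.discreteArc R.carrier δ (R.arc 0)) → (∀ x : Literature.Probability.LatticeModels.Site 2, (∃ e ∈ C₂, x ∈ e) → (∃ y, (Literature.Probability.LatticeModels.discreteDomainGraph R.carrier δ).Adj x y) → x ∈ Literature.Probability.LatticeModels.discreteArc R.carrier δ (R.arc 2)) → (∀ x : Literature.Probability.LatticeModels.Site 2, (∃ e ∈ C₀, x ∈ e) → ¬ ∃ e ∈ C₂, x ∈ e) → (∀ x ∈ Literature.Probability.LatticeModels.DiscreteRect.blackVerts E d₀ n 0, ∀ e ∈ E, x ∈ e → e ∈ C₀) → (∀ y ∈ Literature.Probability.LatticeModels.DiscreteRect.blackVerts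 E d₀ n 2, ∀ e ∈ E, y ∈ e → e ∈ C₂) → (Literature.Probability.LatticeModels.rcMeasure (Literature.Probability.LatticeModels.DiscreteRect.graph E) p q ({x | x.1 ∈ Literature.Probability.LatticeModels.DiscreteRect.blackVerts E d₀ n 0} ∪ {x | x.1 ∈ Literature.Probability.LatticeModels.DiscreteRect.blackVerts E d₀ n 2})).real (Literature.Probability.LatticeModels.arcCrossing {x | x.1 ∈ Literature.Probability.LatticeModels.DiscreteRect.blackVerts E d₀ n 0} {x | x.1 ∈ Literature.Probability.LatticeModels.DiscreteRect.blackVerts E d₀ n 2}) ≤ (Literature.Probability.LatticeModels.fkDomainMeasure R.carrier δ p q (R.arc 0 ∪ R.arc 2)).real (Literature.Probability.Percolation.discreteCrossing R.carrier δ (R.arc 0) (R.arc 2))) := by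
  intro R δ p q _ hp hp1 hq _ E d₀ n _ C₀ C₂ h1 h2 h3 h4 h5 h6 h7 h8
  classical
  have hq0 : 0 < q := one_pos.trans_le hq
  set B₀ : Set (Site 2) := DiscreteRect.blackVerts E d₀ n 0
  set B₂ : Set (Site 2) := DiscreteRect.blackVerts E d₀ n 2
  -- the common vertex type and the two inclusions
  set S : Finset (Site 2) := (meshDomain R.carrier δ).toFinset ∪ DiscreteRect.verts E
  obtain ⟨jΩ, hjΩ⟩ : ∃ jΩ : meshDomain R.carrier δ ↪ {x // x ∈ S}, ∀ u, (jΩ u).1 = u.1 :=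
    ⟨⟨fun u => ⟨u.1, Finset.mem_union_left _ (Set.mem_toFinset.2 u.2)⟩,
      fun u v h => Subtype.ext (by simpa using congrArg Subtype.val h)⟩, fun _ => rfl⟩
  obtain ⟨jE, hjE⟩ : ∃ jE : ((DiscreteRect.verts E : Finset (Site 2)) : Set (Site 2)) ↪
      {x // x ∈ S}, ∀ a, (jE a).1 = a.1 :=
    ⟨⟨fun a => ⟨a.1, Finset.mem_union_right _ (Finset.mem_coe.1 a.2)⟩,
      fun a b h => Subtype.ext (by simpa using congrArg Subtype.val h)⟩, fun _ => rfl⟩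
  -- Step 1: the left side on `V`; the right side as an `rcMeasure` probability
  rw [lhs_eq E hp hq0 jE, fkDomainMeasure_real_discreteCrossing_eq R δ hp hq0]
  set EΩ : Finset (Sym2 {x // x ∈ S}) := (domainSubgraph R.carrier δ).edgeFinset.map jΩ.sym2Map
    with hEΩdef
  set EQ : Finset (Sym2 {x // x ∈ S}) := (DiscreteRect.graph E).edgeFinset.map jE.sym2Map
  have hEΩ : ∀ e, e ∈ EΩ ↔ ∃ a b, (domainSubgraph R.carrier δ).Adj a b ∧ e = s(jΩ a, jΩ b) :=
    fun e => mem_map_sym2Map_iff jΩ _ e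
  have hEQ : ∀ e, e ∈ EQ ↔ ∃ a b, (DiscreteRect.graph E).Adj a b ∧ e = s(jE a, jE b) :=
    fun e => mem_map_sym2Map_iff jE _ e
  have hnd : ∀ e ∈ EΩ ∪ EQ, ¬ e.IsDiag := fun e he => (Finset.mem_union.1 he).elim
    (fun h => not_isDiag_of_mem_map jΩ _ h) (fun h => not_isDiag_of_mem_map jE _ h)
  -- Step 2: the abstract lower sandwich on `G = ⟨EΩ ∪ EQ⟩`
  have hGs : ∀ e ∈ (fromEdgeSet ((EΩ ∪ EQ : Finset _) : Set (Sym2 {x // x ∈ S}))).edgeSet,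
      e ∈ EΩ ∨ e ∈ EQ := fun e he => by
    rw [edgeSet_fromEdgeSet] at he
    exact Finset.mem_union.1 (Finset.mem_coe.1 he.1)
  refine (stub_loopSymmetricLimit_sandwichLower {x // x ∈ S}
    (fromEdgeSet ((EΩ ∪ EQ : Finset _) : Set (Sym2 {x // x ∈ S}))) p q hp hp1 hq EΩ EQ
    (fun e he => (mem_edgeFinset_fromEdgeSet_iff_of_not_isDiag hnd).2
      (Finset.mem_union_left _ he))
    (fun e he => (mem_edgeFinset_fromEdgeSet_iff_of_not_isDiag hnd).2
      (Finset.mem_union_right _ he))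
    (jE '' ({a | a.1 ∈ B₀} ∪ {a | a.1 ∈ B₂})) (jΩ '' (rectArc R δ 0 ∪ rectArc R δ 2))
    (fun e he heΩ x hx => attach Subtype.val_injective hjΩ hjE hEΩ hEQ h3 h4 h5
      (Finset.mem_union.1 ((mem_edgeFinset_fromEdgeSet_iff_of_not_isDiag hnd).1 he)) heΩ hx) ?_
    (arcCrossing (jE '' {a | a.1 ∈ B₀}) (jE '' {a | a.1 ∈ B₂}))
    {ω | ω ∩ (EΩ : Set (Sym2 {x // x ∈ S})) ∈
      arcCrossing (jΩ '' rectArc R δ 0) (jΩ '' rectArc R δ 2)}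
    (isUpperSet_arcCrossing _ _)
    (fun ω ω' hle hω => isUpperSet_arcCrossing _ _ (Set.inter_subset_inter_left _ hle) hω)
    (fun ω ω' h => by rw [Set.mem_setOf_eq, Set.mem_setOf_eq, h])
    (fun ω hω hAQ => forces Subtype.val_injective hjΩ hjE hEΩ hEQ h1 h2 h3 h4 h5 h6 h7 h8 hGs
      hω hAQ)).trans ?_
  · -- the black vertices (off `meshDomain`) are idle
    rintro _ ⟨a, ha, rfl⟩
    exact Or.inr fun e' he' hae' => h2 _ ha ((hjE a) ▸ (val_mem_of_mem_EΩ hjΩ hEΩ he' hae').1)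
  -- Step 3: the right side
  rcases Set.eq_empty_or_nonempty (rectArc R δ 0 ∪ rectArc R δ 2) with h0 | hne
  · have hA : {ω : BondConfig {x // x ∈ S} | ω ∩ (EΩ : Set (Sym2 {x // x ∈ S})) ∈
        arcCrossing (jΩ '' rectArc R δ 0) (jΩ '' rectArc R δ 2)} = ∅ :=
      Set.subset_empty_iff.1 fun ω ⟨_, ⟨u, hu, _⟩, _⟩ =>
        Set.eq_empty_iff_forall_notMem.1 h0 u (Or.inl hu)
    rw [hA, measureReal_empty]
    exact measureReal_nonneg
  · exact (rhs_eq R δ hp hq0 jΩ EΩ hEΩdef hne).le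

end Summit.CriticalPhenomena.CardyFormulaZ2.Theorems.CardyQContinuation
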